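import Literature.NumberTheory.Sieve.BombieriFriedlanderIwaniecDispersionS2
import HarnessLib

/-!
# Bombieri–Friedlander–Iwaniec 1986, §5 for Theorem 2: `𝒮₂ = f̂(0) X + ℛ₂` with the uniform Poisson error

Topic `Literature/NumberTheory/Sieve`.  Companion of `…DispersionS2` (§5 of E. Bombieri,
J. B. Friedlander, H. Iwaniec, *Primes in arithmetic progressions to large moduli*, Acta Math. 156
(1986), 203–251, in the form needed for Theorem 1, where the moduli `νq₁r` stay below the length
of the smooth variable so that no nonzero frequency survives).  For **Theorem 2** (the named fact
`Literature.NumberTheory.Sieve.BombieriFriedlanderIwaniecTheorem2`) the moduli may exceed `M`, but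
the range of Theorem 2 gives `QNR < x^{1−ε}` (from `N < x^{−ε}(x²/Q³)^{1/4}` and `R < N x^{−ε}`), and
then the nonzero frequencies of §5 can be bounded TRIVIALLY, through the uniform estimate
`∑_{m ≡ c (k)} f(m) = f̂(0)/k + O((M+2Y)/Y + K₂)` (Poisson summation with the split point
`H₀ = ⌊k/Y⌋`), without the incomplete Kloosterman sums (5.3) / Weil's bound that BFI use to cover
all of Theorems 1–4 at once.  This file PROVES that form.  Everything here is PROVED; no named facts
are introduced.

## Contents

* `BFI.classErr M Y = 2(M+2Y)/Y + K₂`, `BFI.classErr_nonneg`.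
* **`BFI.norm_classSum_sub_le_uniform`**: `‖A(k,c) − α̂₀/k‖ ≤ classErr` for every `k ≥ 1` and
  every class `c` (from the tree's `BFI.norm_classSum_sub_le` with `H₀ = ⌊k/Y⌋`).
* **`BFI.norm_sum_coprime_class_sub_le_uniform`** (the inner sum of `𝒮₂`, BFI (5.1): Möbius
  inversion of `(m,q)=1` and Poisson modulo `νd`, error `τ(q)·classErr`),
  `BFI.norm_mA2_term_sub_le_uniform`, and **`BFI.norm_dS2_sub_mainX_le_uniform`**:
  `‖𝒮₂ − α̂₀ X‖ ≤ ∑_{r∼R}∑_{q₁,q₂∼Q} |γ_{q₁}γ_{q₂}| (∑_{n∼N}|β_n|)² τ(q₂)/φ(q₂r) · (2(M+2Y)/Y + K₂)`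
  (the proofs follow `…DispersionS2` line by line, with the uniform error in place of the
  tail-hypothesis/trivial-count dichotomy).

## Faithfulness

BFI (5.4): `R₂ ≪ ‖β‖²(QR⁻¹N^{3/2} + Q)x^ε + ‖β‖²R⁻¹x^{1−ε}`, acceptable for (3.3) if
`N < (x/Q)^{2/3}x^{−ε}` and `QR < x^{1−ε}`.  The present bound is `≪ ‖β‖² N Q ℒ^c` after the
divisor-sum averaging of the assembly (`∑|β| ≤ (N‖β‖²)^{1/2}`·…, `∑ 1/φ(q₂r)` bounded), which is
acceptable for (3.3) precisely when `QNR ≪ x ℒ^{−A−c}` — weaker than (5.4) in general but implied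
by the range of Theorem 2, which is all that is used downstream.

## References

* E. Bombieri, J. B. Friedlander, H. Iwaniec, Acta Math. 156 (1986), 203–251, §5 (5.1)–(5.4)
  pp. 216–218; §2 Lemma 2 p. 209. [BombieriFriedlanderIwaniecActa1986]
-/

noncomputable section

open Finset Real
open scoped ArithmeticFunction.sigma

namespace Literature.NumberTheory.Sieve

namespace BFI

/-- The uniform Poisson error constant `E = 2(M+2Y)/Y + K₂`. [folklore] -/
def classErr (M Y : ℝ) : ℝ := 2 * (M + 2 * Y) / Y + derivConst 2

/-- `E ≥ 0` for `0 < Y`, `0 ≤ M`. [folklore] -/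
theorem classErr_nonneg {M Y : ℝ} (hY : 0 < Y) (hM : 0 ≤ M) : 0 ≤ classErr M Y := by
  unfold classErr; have := one_le_derivConst 2; positivity

/-- **Uniform Poisson error for one congruence sum**: for `k ≥ 1`, `0 < Y ≤ M` and every class `c`,
`‖A(k, c) − α̂₀/k‖ ≤ 2(M+2Y)/Y + K₂` (Poisson summation `BFI.norm_classSum_sub_le` with the split
point `H₀ = ⌊k/Y⌋`: the `H₀` first frequencies trivially, the rest by two partial integrations).
[cite: BombieriFriedlanderIwaniecActa1986, §2 Lemma 2 p. 209] -/
theorem norm_classSum_sub_le_uniform {M Y : ℝ} (hY : 0 < Y) (hYM : Y ≤ M) {k : ℕ} (hk : 0 < k)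
    (c : ZMod k) :
    ‖(classSum M Y k c : ℂ) - (k : ℂ)⁻¹ * alphaHat M Y‖ ≤ classErr M Y := by
  have hM : 0 ≤ M := hY.le.trans hYM
  set H₀ : ℕ := ⌊(k : ℝ) / Y⌋₊ with hH₀
  have hP := norm_classSum_sub_le hY hYM hk c H₀ (le_refl 2)
  have hk0 : (0 : ℝ) < k := by exact_mod_cast hk
  -- the oscillatory part, trivially
  have hosc : ‖oscSum M Y k c H₀‖ ≤ 2 * H₀ * (M + 2 * Y) := by
    unfold oscSum
    refine (norm_sum_le _ _).trans ?_
    calc ∑ h ∈ Finset.Icc 1 H₀, ‖twCoef M Y k c h + twCoef M Y k c (-(h : ℤ))‖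
        ≤ ∑ h ∈ Finset.Icc 1 H₀, (M + 2 * Y + (M + 2 * Y)) := by
          refine Finset.sum_le_sum fun h _ => (norm_add_le _ _).trans ?_
          rw [norm_twCoef, norm_twCoef]
          exact add_le_add (norm_fcoef_le hY hM k _) (norm_fcoef_le hY hM k _)
      _ = 2 * H₀ * (M + 2 * Y) := by rw [Finset.sum_const, Nat.card_Icc, nsmul_eq_mul]; push_cast; ring
  -- the tail
  have hK₂ := one_le_derivConst 2
  have hH₀Y : (k : ℝ) / Y ≤ (H₀ : ℝ) + 1 := (Nat.lt_floor_add_one _).le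
  have hH₀le : (H₀ : ℝ) ≤ (k : ℝ) / Y := Nat.floor_le (by positivity)
  have htail : (k : ℝ)⁻¹ * tailBound Y 2 k H₀ ≤ derivConst 2 := by
    unfold tailBound
    have hπ : (16 : ℝ) ≤ (2 * π) ^ 2 := by nlinarith [Real.pi_gt_three]
    have e : (k : ℝ)⁻¹ * (16 * derivConst 2 * Y⁻¹ ^ 2 * Y * ((k : ℝ) / (2 * π)) ^ 2 *
        (((H₀ : ℝ) + 1) ^ (2 - 1))⁻¹) = 16 * derivConst 2 / (2 * π) ^ 2 * ((k / Y) / ((H₀ : ℝ) + 1)) := by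
      rw [show (2 : ℕ) - 1 = 1 by norm_num, pow_one]
      field_simp
    rw [e]
    have h1 : (k : ℝ) / Y / ((H₀ : ℝ) + 1) ≤ 1 := by
      rw [div_le_one (by positivity)]; exact hH₀Y
    calc 16 * derivConst 2 / (2 * π) ^ 2 * ((k : ℝ) / Y / ((H₀ : ℝ) + 1))
        ≤ 16 * derivConst 2 / 16 * 1 := by
          refine mul_le_mul (div_le_div_of_nonneg_left (by positivity) (by norm_num) hπ) h1
            (by positivity) (by positivity)
      _ = derivConst 2 := by ring
  -- assemble: `A − α̂₀/k = (A − k⁻¹(α̂₀ + osc)) + k⁻¹ osc`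
  have e1 : (classSum M Y k c : ℂ) - (k : ℂ)⁻¹ * alphaHat M Y =
      ((classSum M Y k c : ℂ) - (k : ℂ)⁻¹ * (alphaHat M Y + oscSum M Y k c H₀)) +
        (k : ℂ)⁻¹ * oscSum M Y k c H₀ := by ring
  rw [e1]
  refine (norm_add_le _ _).trans ?_
  unfold classErr
  have h2 : ‖(k : ℂ)⁻¹ * oscSum M Y k c H₀‖ ≤ 2 * (M + 2 * Y) / Y := by
    rw [norm_mul, norm_inv, Complex.norm_natCast]
    calc (k : ℝ)⁻¹ * ‖oscSum M Y k c H₀‖ ≤ (k : ℝ)⁻¹ * (2 * H₀ * (M + 2 * Y)) :=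
          mul_le_mul_of_nonneg_left hosc (by positivity)
      _ ≤ (k : ℝ)⁻¹ * (2 * ((k : ℝ) / Y) * (M + 2 * Y)) := by gcongr
      _ = 2 * (M + 2 * Y) / Y := by field_simp
  linarith [hP.trans htail, h2]


/-- **The inner sum of `𝒮₂` with the uniform Poisson error** (BFI §5 (5.1): Möbius inversion of
`(m, q) = 1`, then Lemma 2 modulo each `νd`): for `0 < Y ≤ M`, `q, d ≥ 1` and a reduced class
`c (mod d)`,
`‖∑_{m ∈ mRange, (m,q)=1, m≡c (d)} f(m) − f̂(0) φ(qd)/(dqφ(d))‖ ≤ τ(q) (2(M+2Y)/Y + K₂)`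
(no restriction on the size of the moduli `νd`).
[cite: BombieriFriedlanderIwaniecActa1986, §5 (5.1) p. 216] -/
theorem norm_sum_coprime_class_sub_le_uniform {M Y : ℝ} (hY : 0 < Y) (hYM : Y ≤ M) {q d : ℕ}
    (hq : 0 < q) (hd : 0 < d) {c : ZMod d} (hc : IsUnit c) :
    ‖((∑ m ∈ (mRange M Y).filter (fun m : ℕ => m.Coprime q ∧ (m : ZMod d) = c),
          bump M Y m : ℝ) : ℂ) -
        alphaHat M Y * (((Nat.totient (q * d) : ℝ) / (d * (q * (Nat.totient d : ℝ))) : ℝ) : ℂ)‖ ≤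
      (σ 0 q : ℝ) * classErr M Y := by
  have hM : 0 ≤ M := hY.le.trans hYM
  haveI : NeZero d := ⟨hd.ne'⟩
  set S' : Finset ℕ := (mRange M Y).filter (fun m : ℕ => (m : ZMod d) = c) with hS'
  set I : ℕ → ℝ := fun ν => ∑ m ∈ S'.filter (fun m => ν ∣ m), bump M Y m with hI
  have hB : ∑ m ∈ (mRange M Y).filter (fun m : ℕ => m.Coprime q ∧ (m : ZMod d) = c), bump M Y m =
      ∑ ν ∈ q.divisors, (ArithmeticFunction.moebius ν : ℝ) * I ν := by
    have e : (mRange M Y).filter (fun m : ℕ => m.Coprime q ∧ (m : ZMod d) = c) =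
        S'.filter (fun m => m.Coprime q) := by
      rw [hS', Finset.filter_filter]
      exact Finset.filter_congr fun m _ => by tauto
    rw [e, sum_filter_coprime_eq_sum_divisors_real S' _ hq]
  have hc' : (c.val).Coprime d := ZMod.val_coe_unit_coprime hc.unit
  have hvan : ∀ ν ∈ q.divisors, ¬ν.Coprime d → I ν = 0 := by
    intro ν _ hνd
    refine Finset.sum_eq_zero fun m hm => ?_
    exfalso
    rw [Finset.mem_filter, hS', Finset.mem_filter] at hm
    obtain ⟨⟨_, hmc⟩, hνm⟩ := hm
    apply hνd
    have hmd : m.Coprime d := by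
      have h1 : m % d = c.val % d := by
        rw [← ZMod.natCast_eq_natCast_iff', ZMod.natCast_zmod_val]
        exact hmc
      have h2 : Nat.gcd (c.val % d) d = 1 := by
        rw [← Nat.gcd_rec, Nat.gcd_comm]
        exact hc'
      show Nat.gcd m d = 1
      rw [Nat.gcd_comm, Nat.gcd_rec, h1]
      exact h2
    exact Nat.Coprime.coprime_dvd_left hνm hmd
  -- the coprime `ν`: uniform Poisson error
  have hunif : ∀ ν ∈ q.divisors, ∀ hνd : ν.Coprime d,
      ‖(I ν : ℂ) - alphaHat M Y * ((ν : ℂ) * d)⁻¹‖ ≤ classErr M Y := by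
    intro ν hν hνd
    have hν0 := Nat.pos_of_mem_divisors hν
    have hk : 0 < ν * d := Nat.mul_pos hν0 hd
    have hIe : I ν = classSum M Y (ν * d) (crtClass hνd c) :=
      sum_filter_dvd_class_eq_classSum M Y hνd c
    have hP := norm_classSum_sub_le_uniform hY hYM hk (crtClass hνd c)
    push_cast at hP
    calc ‖(I ν : ℂ) - alphaHat M Y * ((ν : ℂ) * d)⁻¹‖
        = ‖(classSum M Y (ν * d) (crtClass hνd c) : ℂ) - ((ν : ℂ) * d)⁻¹ * alphaHat M Y‖ := by
          rw [hIe, mul_comm (alphaHat M Y)]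
      _ ≤ classErr M Y := hP
  have hMT : alphaHat M Y *
        (((Nat.totient (q * d) : ℝ) / (d * (q * (Nat.totient d : ℝ))) : ℝ) : ℂ) =
      ∑ ν ∈ q.divisors, (ArithmeticFunction.moebius ν : ℂ) *
        (if ν.Coprime d then alphaHat M Y * ((ν : ℂ) * d)⁻¹ else 0) := by
    have hsum := sum_divisors_filter_coprime_moebius_div hq hd
    rw [Finset.sum_filter] at hsum
    have hd0 : (d : ℝ) ≠ 0 := by exact_mod_cast hd.ne'
    have e : (Nat.totient (q * d) : ℝ) / (d * (q * (Nat.totient d : ℝ))) =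
        (d : ℝ)⁻¹ * ∑ ν ∈ q.divisors,
          (if ν.Coprime d then (ArithmeticFunction.moebius ν : ℝ) / ν else 0) := by
      rw [hsum]
      ring
    rw [e]
    push_cast
    rw [Finset.mul_sum, Finset.mul_sum]
    refine Finset.sum_congr rfl fun ν hν => ?_
    have hν0 : (ν : ℂ) ≠ 0 := by exact_mod_cast (Nat.pos_of_mem_divisors hν).ne'
    have hd0' : (d : ℂ) ≠ 0 := by exact_mod_cast hd.ne'
    split_ifs
    · push_cast
      field_simp
    · simp
  have hE0 : 0 ≤ classErr M Y := classErr_nonneg hY hM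
  rw [hB, hMT]
  push_cast
  rw [← Finset.sum_sub_distrib]
  refine (norm_sum_le _ _).trans ?_
  calc ∑ ν ∈ q.divisors, ‖(ArithmeticFunction.moebius ν : ℂ) * (I ν : ℂ) -
          (ArithmeticFunction.moebius ν : ℂ) *
            (if ν.Coprime d then alphaHat M Y * ((ν : ℂ) * d)⁻¹ else 0)‖
      ≤ ∑ ν ∈ q.divisors, classErr M Y := by
        refine Finset.sum_le_sum fun ν hν => ?_
        by_cases hνd : ν.Coprime d
        · rw [if_pos hνd, ← mul_sub, norm_mul]
          have hμ : ‖(ArithmeticFunction.moebius ν : ℂ)‖ ≤ 1 := by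
            rw [Complex.norm_intCast]
            exact_mod_cast ArithmeticFunction.abs_moebius_le_one
          calc ‖(ArithmeticFunction.moebius ν : ℂ)‖ *
                ‖(I ν : ℂ) - alphaHat M Y * ((ν : ℂ) * d)⁻¹‖
              ≤ 1 * classErr M Y := mul_le_mul hμ (hunif ν hν hνd) (norm_nonneg _) zero_le_one
            _ = _ := one_mul _
        · rw [if_neg hνd, hvan ν hν hνd]
          simp only [Complex.ofReal_zero, mul_zero, sub_zero, norm_zero]
          exact hE0
    _ = (σ 0 q : ℝ) * classErr M Y := by
        rw [Finset.sum_const, nsmul_eq_mul, ArithmeticFunction.sigma_zero_apply]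

/-- One term of `𝒮₂ − f̂(0) X` with the uniform Poisson error: for `r, q₁, q₂ ≥ 1` and every `n₁`,
`‖β_{n₁} A₂ − α̂₀ [(k,a)=1][(n₁,d)=1] β_{n₁} φ(k)/(k φ(d))‖ ≤ |β_{n₁}| τ(q₂) (2(M+2Y)/Y + K₂)`.
[cite: BombieriFriedlanderIwaniecActa1986, §5 pp. 216–217] -/
theorem norm_mA2_term_sub_le_uniform {M Y : ℝ} (hY : 0 < Y) (hYM : Y ≤ M) (a : ℤ) {r q₁ q₂ : ℕ}
    (hr : 0 < r) (hq₁ : 0 < q₁) (hq₂ : 0 < q₂) (β : ℕ → ℝ) (n₁ : ℕ) :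
    ‖((β n₁ * mA2 a (mRange M Y) (fun m => bump M Y m) r q₁ q₂ n₁ : ℝ) : ℂ) -
        alphaHat M Y * ((if IsCoprime ((q₁ * q₂ * r : ℕ) : ℤ) a ∧ n₁.Coprime (q₁ * r) then
          β n₁ * ((Nat.totient (q₁ * q₂ * r) : ℝ) /
            ((q₁ * q₂ * r : ℕ) * (Nat.totient (q₁ * r) : ℝ))) else 0 : ℝ) : ℂ)‖ ≤
      |β n₁| * ((σ 0 q₂ : ℝ) * classErr M Y) := by
  have hM : 0 ≤ M := hY.le.trans hYM
  have hd : 0 < q₁ * r := Nat.mul_pos hq₁ hr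
  rw [mA2_bump_eq]
  by_cases h : IsCoprime ((q₁ * q₂ * r : ℕ) : ℤ) a ∧ n₁.Coprime (q₁ * r)
  · rw [if_pos h, if_pos h]
    obtain ⟨hka, hn⟩ := h
    have hda : IsCoprime ((q₁ * r : ℕ) : ℤ) a := by
      apply IsCoprime.of_mul_left_left (y := (q₂ : ℤ))
      have e : ((q₁ * r : ℕ) : ℤ) * q₂ = ((q₁ * q₂ * r : ℕ) : ℤ) := by push_cast; ring
      rwa [e]
    have hB := norm_sum_coprime_class_sub_le_uniform hY hYM hq₂ hd (isUnit_invClass hda hn)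
    have ek : q₂ * (q₁ * r) = q₁ * q₂ * r := by ring
    rw [ek] at hB
    have e1 : ((Nat.totient (q₁ * q₂ * r) : ℝ) /
        ((q₁ * q₂ * r : ℕ) * (Nat.totient (q₁ * r) : ℝ))) =
        (Nat.totient (q₁ * q₂ * r) : ℝ) / ((q₁ * r : ℕ) * (q₂ * (Nat.totient (q₁ * r) : ℝ))) := by
      push_cast
      ring
    rw [e1]
    have e2 : ∀ (A Bm : ℝ), ((β n₁ * A : ℝ) : ℂ) - alphaHat M Y * ((β n₁ * Bm : ℝ) : ℂ) =
        (β n₁ : ℂ) * ((A : ℂ) - alphaHat M Y * (Bm : ℂ)) := by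
      intro A Bm
      push_cast
      ring
    rw [e2, norm_mul, Complex.norm_real, Real.norm_eq_abs]
    exact mul_le_mul_of_nonneg_left hB (abs_nonneg _)
  · rw [if_neg h, if_neg h]
    simp only [mul_zero, Complex.ofReal_zero, sub_zero, norm_zero]
    have := classErr_nonneg hY hM
    positivity

/-- **`𝒮₂ = f̂(0) X + ℛ₂` with the uniform Poisson error** (BFI §5 (5.4), in the form sufficient
for Theorem 2: the nonzero frequencies are bounded trivially through the uniform estimate
`∑_{m≡c (k)} f(m) = f̂(0)/k + O((M+2Y)/Y)` — in the range of Theorem 2, `QNR < x^{1−ε}`, this is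
admissible and Weil's bound (5.3) is not needed): for `0 < Y ≤ M`, `Q, R ≥ 0`,
`‖𝒮₂ − α̂₀ X‖ ≤ ∑_{r∼R}∑_{q₁,q₂∼Q} |γ_{q₁}γ_{q₂}| (∑_{n∼N}|β_n|)² τ(q₂)/φ(q₂r) · (2(M+2Y)/Y + K₂)`.
[cite: BombieriFriedlanderIwaniecActa1986, §5 (5.1)–(5.4) pp. 216–218] -/
theorem norm_dS2_sub_mainX_le_uniform {M Y : ℝ} (hY : 0 < Y) (hYM : Y ≤ M) (a : ℤ) {N Q R : ℝ}
    (hQ : 0 ≤ Q) (hR : 0 ≤ R) (β γ : ℕ → ℝ) :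
    ‖(dS2 a (mRange M Y) N Q R (fun m => bump M Y m) β γ : ℂ) -
        alphaHat M Y * (mainX a N Q R β γ : ℂ)‖ ≤
      ∑ r ∈ dyadic R, ∑ q₁ ∈ dyadic Q, ∑ q₂ ∈ dyadic Q,
        |γ q₁| * |γ q₂| * (∑ n ∈ dyadic N, |β n|) ^ 2 *
          ((σ 0 q₂ : ℝ) / (Nat.totient (q₂ * r) : ℝ)) * classErr M Y := by
  have hM : 0 ≤ M := hY.le.trans hYM
  have hE0 : 0 ≤ classErr M Y := classErr_nonneg hY hM
  have halg : ∀ (U A B : ℂ), U * A - alphaHat M Y * (U * B) = U * (A - alphaHat M Y * B) := by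
    intros; ring
  -- per-triple bound
  have key : ∀ r ∈ dyadic R, ∀ q₁ ∈ dyadic Q, ∀ q₂ ∈ dyadic Q,
      ‖((γ q₁ * γ q₂ * (cSum N β (q₂ * r) / (Nat.totient (q₂ * r) : ℝ)) *
            ∑ n₁ ∈ dyadic N, β n₁ * mA2 a (mRange M Y) (fun m => bump M Y m) r q₁ q₂ n₁ : ℝ) : ℂ) -
        alphaHat M Y * ((γ q₁ * γ q₂ * (cSum N β (q₂ * r) / (Nat.totient (q₂ * r) : ℝ)) *
            ∑ n₁ ∈ dyadic N, (if IsCoprime ((q₁ * q₂ * r : ℕ) : ℤ) a ∧ n₁.Coprime (q₁ * r) then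
              β n₁ * ((Nat.totient (q₁ * q₂ * r) : ℝ) /
                ((q₁ * q₂ * r : ℕ) * (Nat.totient (q₁ * r) : ℝ))) else 0) : ℝ) : ℂ)‖ ≤
        |γ q₁| * |γ q₂| * (∑ n ∈ dyadic N, |β n|) ^ 2 *
          ((σ 0 q₂ : ℝ) / (Nat.totient (q₂ * r) : ℝ)) * classErr M Y := by
    intro r hr q₁ hq₁ q₂ hq₂
    have hr0 := pos_of_mem_dyadic hR hr
    have hq₁0 := pos_of_mem_dyadic hQ hq₁
    have hq₂0 := pos_of_mem_dyadic hQ hq₂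
    have hφ₂ : (0 : ℝ) < (Nat.totient (q₂ * r) : ℝ) := by
      exact_mod_cast Nat.totient_pos.2 (Nat.mul_pos hq₂0 hr0)
    have hu_le : |γ q₁ * γ q₂ * (cSum N β (q₂ * r) / (Nat.totient (q₂ * r) : ℝ))| ≤
        |γ q₁| * |γ q₂| * ((∑ n ∈ dyadic N, |β n|) / (Nat.totient (q₂ * r) : ℝ)) := by
      rw [abs_mul, abs_mul, abs_div, abs_of_pos hφ₂]
      gcongr
      exact abs_cSum_le N β _
    simp only [Complex.ofReal_mul, Complex.ofReal_sum]
    rw [halg, norm_mul, ← Complex.ofReal_mul, ← Complex.ofReal_mul, Complex.norm_real,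
      Real.norm_eq_abs]
    have hsum : ‖(∑ n₁ ∈ dyadic N,
        ((β n₁ : ℝ) : ℂ) * ((mA2 a (mRange M Y) (fun m => bump M Y m) r q₁ q₂ n₁ : ℝ) : ℂ)) -
          alphaHat M Y * ∑ n₁ ∈ dyadic N,
            ((if IsCoprime ((q₁ * q₂ * r : ℕ) : ℤ) a ∧ n₁.Coprime (q₁ * r) then
              β n₁ * ((Nat.totient (q₁ * q₂ * r) : ℝ) /
                ((q₁ * q₂ * r : ℕ) * (Nat.totient (q₁ * r) : ℝ))) else 0 : ℝ) : ℂ)‖ ≤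
        (∑ n ∈ dyadic N, |β n|) * ((σ 0 q₂ : ℝ) * classErr M Y) := by
      rw [Finset.mul_sum, ← Finset.sum_sub_distrib]
      refine (norm_sum_le _ _).trans ?_
      rw [Finset.sum_mul]
      refine Finset.sum_le_sum fun n₁ _ => ?_
      rw [← Complex.ofReal_mul]
      exact norm_mA2_term_sub_le_uniform hY hYM a hr0 hq₁0 hq₂0 β n₁
    have hS := Finset.sum_nonneg (fun n (_ : n ∈ dyadic N) => abs_nonneg (β n))
    refine (mul_le_mul hu_le hsum (norm_nonneg _) (by positivity)).trans (le_of_eq ?_)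
    rw [sq]
    field_simp
  rw [dS2_eq, mainX_eq_sum₄, Complex.ofReal_sum, Complex.ofReal_sum, Finset.mul_sum,
    ← Finset.sum_sub_distrib]
  refine (norm_sum_le _ _).trans (Finset.sum_le_sum fun r hr => ?_)
  rw [Complex.ofReal_sum, Complex.ofReal_sum, Finset.mul_sum, ← Finset.sum_sub_distrib]
  refine (norm_sum_le _ _).trans (Finset.sum_le_sum fun q₁ hq₁ => ?_)
  rw [Complex.ofReal_sum, Complex.ofReal_sum, Finset.mul_sum, ← Finset.sum_sub_distrib]
  refine (norm_sum_le _ _).trans (Finset.sum_le_sum fun q₂ hq₂ => ?_)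
  exact key r hr q₁ hq₁ q₂ hq₂

end BFI

end Literature.NumberTheory.Sieve
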